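import Summits.Ventures.YMGap.RobustBall.RectangleWitness
import Summits.Ventures.YMGap.RobustBall.TermPerturbationFine
import HarnessLib

/-!
# RobustBall/RectangleWitnessFine — T0.2 witness (w1) in the reads-incidence ball (`FineBall` upgrade)
(cell `pub-ymgap`, track Y2 ROBUST-BALL; p1)

HONEST FRAMING: a MEMBERSHIP CERTIFICATE (finite-torus bookkeeping only; no expansion, no continuum, no Clay claim):
the same `1×2`-rectangle perturbation as in `RobustBall/RectangleWitness`, now placed in the READS-incidence ball of
`RobustBall/FineBall` with the sharper Lipschitz load `36(d−1)|τ|/√N` (only the `6(d−1)` rectangles through a LINK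
are charged, six letters each) — `RectangleWitnessFineTarget N d` AS TYPED. Uses the injectivity of the rectangle code
(`3 ≤ L`) through `SameLinksOnFibers`.
-/

noncomputable section

open MeasureTheory Finset Function
open Literature.Probability.LatticeModels Literature.Probability.LatticeModels.DobrushinMetric
open Literature.MathematicalPhysics.QuantumLattice hiding torusNorm
open Literature.MathematicalPhysics.QuantumFieldTheory hiding ZdEdge

namespace Summit.Ventures.YMGap.RobustBall

variable {d L : ℕ} [NeZero L] (N : ℕ) (τ : ℝ)

/-- **The link count** (reads incidence): the Lipschitz mass of the rectangles THROUGH the link `e`: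
`Σ_{r : e ∈ links(w_r)} (|τ|/√N)·6 ≤ (|τ|/√N)·6·Σ_r mult_r(e) = 36(d−1)|τ|/√N`. [folklore] -/
theorem sum_link_rectFamily_le (e : Edge d L) :
    ∑ r, (if e ∈ wordEdges (rectFamily d L N τ r).letters then
        (rectFamily d L N τ r).lipC * ((rectFamily d L N τ r).letters.length : ℝ) else 0) ≤
      36 * ((d : ℝ) - 1) * |τ| / Real.sqrt N := by
  have hc : 0 ≤ |τ| / Real.sqrt N := by positivity
  have hle : ∀ r : Site d L × DirPair d,
      (if e ∈ wordEdges (rectFamily d L N τ r).letters then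
          (rectFamily d L N τ r).lipC * ((rectFamily d L N τ r).letters.length : ℝ) else 0) ≤
        6 * (|τ| / Real.sqrt N) * (mult (rectWord r.1 r.2.1.1 r.2.1.2) e : ℝ) := by
    intro r
    simp only [rectFamily_letters, rectFamily_lipC, length_rectWord, Nat.cast_ofNat]
    split_ifs with h
    · have h1 : 1 ≤ mult (rectWord r.1 r.2.1.1 r.2.1.2) e :=
        Nat.one_le_iff_ne_zero.2 fun h0 => (mult_eq_zero_iff.1 h0) h
      have h1' : (1 : ℝ) ≤ mult (rectWord r.1 r.2.1.1 r.2.1.2) e := by exact_mod_cast h1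
      nlinarith
    · positivity
  calc ∑ r, (if e ∈ wordEdges (rectFamily d L N τ r).letters then
          (rectFamily d L N τ r).lipC * ((rectFamily d L N τ r).letters.length : ℝ) else 0)
      ≤ ∑ r : Site d L × DirPair d, 6 * (|τ| / Real.sqrt N) * (mult (rectWord r.1 r.2.1.1 r.2.1.2) e : ℝ) :=
        sum_le_sum fun r _ => hle r
    _ = 36 * ((d : ℝ) - 1) * |τ| / Real.sqrt N := by
        rw [← mul_sum, sum_mult_rectFamily_real]
        ring

/-- **Membership in the reads-incidence ball**: for `3 ≤ L` the rectangle perturbation lies in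
`ClusterDomainFRFine (12(d−1)|τ|) (36(d−1)|τ|/√N) 2`. [folklore] -/
theorem rectFamily_mem_clusterDomainFRFine (hL : 3 ≤ L) :
    termPerturbation (rectFamily d L N τ) ∈
      ClusterDomainFRFine (12 * ((d : ℝ) - 1) * |τ|) (36 * ((d : ℝ) - 1) * |τ| / Real.sqrt N) 2 := by
  refine termPerturbation_mem_clusterDomainFRFine (rectFamily d L N τ)
    (sameLinksOnFibers_of_injective _ (rectFamily_code_injective N τ hL))
    (fun r => polymerDiam_rectCode_le r.2.2) (fun e => ?_) (fun e => sum_link_rectFamily_le N τ e)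
  simp only [rectFamily_oscC, rectFamily_letters]
  rw [← mul_sum, sum_mult_rectFamily_real]
  linarith

/-- **T0.2 witness (w1) in the READS-incidence ball** (`RobustBall/FineBall`), with the loads of
`RectangleWitnessFineTarget` AS TYPED: oscillation load `12(d−1)|τ|`, Lipschitz load `36(d−1)|τ|/√N`, range `2`,
vertical dependence diameter `2`, centre-slab invariant — for every `τ`, `N`, `d` and every torus `L ≥ 3`. [folklore] -/
theorem rectangleWitnessFineTarget_holds (N d : ℕ) : RectangleWitnessFineTarget N d := by
  intro τ L _ hL
  exact ⟨termPerturbation (rectFamily d L N τ), total_rectFamily N τ, rectFamily_mem_clusterDomainFRFine N τ hL,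
    hasVertRange_rectFamily N τ hL, isSlabLocal_rectFamily N τ hL⟩

end Summit.Ventures.YMGap.RobustBall

end
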